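import Mathlib.LinearAlgebra.Matrix.SpecialLinearGroup
import Mathlib.LinearAlgebra.Matrix.Hermitian
import Mathlib.LinearAlgebra.Matrix.Trace
import Mathlib.Topology.Algebra.Group.Matrix
import Mathlib.Data.Fintype.Parity
import Mathlib.Analysis.InnerProductSpace.Adjoint
import Mathlib.Analysis.Distribution.SchwartzSpace.Basic
import Literature.MathematicalPhysics.QuantumLattice.MinkowskiGeometry
import Literature.MathematicalPhysics.QuantumLattice.WightmanAxioms
import Literature.MathematicalPhysics.QuantumLattice.SpinOperators
import Literature.Analysis.UnboundedOperators.UnitaryRep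
import Literature.Analysis.UnboundedOperators.FourierSpectrum
import HarnessLib

-- provenance: harness21/H21/H21/Prelude/AnalysisL/SpinorWightman.lean @ bd4d529 (interim HEAD d8f2665); M5 mechanical rewrite
/-!
# Spinor Wightman fields: the `SL(2, ℂ)` cover, multiplets, PCT and spin–statistics

Trunk `AnalysisL` (G28), item P13 / notions `wightman_axioms`, `minkowski_poincare_group`.
This module realises the part of the inventory text "fields transforming under a
finite-dimensional representation of `SL(2, ℂ)`" left out of the accepted scalar Wightman layer
`WightmanData` / `IsWightmanQFT` (G13, outline R10), in space-time dimension `d = 3` only.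

## Contents

* **The 2:1 cover `SL(2, ℂ) → L↑₊`** (Streater–Wightman §1-3). `pauliMatrix : Fin 4 → M₂(ℂ)`
  (`σ₀ = 1`, `σ₁, σ₂, σ₃` the accepted Pauli triple `QLattice.spinHalfPauli`),
  `toHermitian x = ∑_μ x^μ σ_μ = x̰` (SW eq. (1-19)) with `det x̰ = η(x, x)`
  (`det_toHermitian`), and the action `spinActFun A x`, defined by
  `(Λ(A) x)̰ = A x̰ Aᴴ`, i.e. `(Λ(A) x)^μ = ½ Re tr (σ_μ A x̰ Aᴴ)`. The facts that `Λ(A)` is a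
  restricted Lorentz transformation, that `A ↦ Λ(A)` is a homomorphism onto `L↑₊` with kernel
  `{±1}` are the sorried theorems `exists_restrictedLorentz_coe_eq_spinActFun`, `spinActFun_mul`,
  `spinActFun_surjective`, `spinActFun_eq_iff` (SW §1-3, eqs. (1-22)–(1-25)).
* **Spinor Wightman data** `SpinorWightmanData κ` (SW §3-1 with `ISL(2, ℂ)`): a Hilbert space,
  a unitary representation of the translations, a unitary representation `A ↦ U(0, A)` of
  `SL(2, ℂ)`, a vacuum, a common domain, and for each species `k : κ` a multiplet of
  `mult k` field components `φ_{k,α}(f)`, `α : Fin (mult k)`, transforming under a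
  finite-dimensional matrix representation `S k : SL(2, ℂ) →* M_{mult k}(ℂ)`, together with a
  Bose/Fermi flag `isFermi k`. The axioms are the `Prop`-valued structure `IsSpinorWightmanQFT`
  (W0–W4 with the spinor transformation law (SW eq. (3-4)) and (anti)commutativity at spacelike
  separation (SW eq. (3-6))).
* **Theorems** (known, proofs `sorry`): the spin–statistics theorem `spin_statistics`
  (SW Thm. 4-10: a field with the *wrong* connection between spin and statistics vanishes), the
  PCT theorem `pct_theorem` (SW Thm. 4-6), and the reduction `IsSpinorWightmanQFT.toWightman` of a
  scalar multiplet theory to the accepted `IsWightmanQFT` (the outline's `toScalar`; the work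
  item fixes the name `toWightman`, an existence statement `∃ W' : WightmanData 3 κ, …`).

## Sources

R. F. Streater, A. S. Wightman, *PCT, Spin and Statistics, and All That* (1964), §1-3
(eqs. (1-19)–(1-30): `SL(2, ℂ)` and `L↑₊`), §3-1 (the axioms for spinor fields, eqs. (3-1)–(3-6)),
§4-3 (Thm. 4-6, PCT), §4-4 (Thm. 4-10, spin and statistics); R. Jost, *The General Theory of
Quantized Fields* (1965), ch. V.

## Mathlib

Used: `Matrix.SpecialLinearGroup (Fin 2) ℂ` with its `Neg` (via `Fact (Even (Fintype.card
(Fin 2)))`, `Mathlib.Data.Fintype.Parity`) and its topology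
(`Mathlib.Topology.Algebra.Group.Matrix`), `Matrix.conjTranspose`, `Matrix.trace`,
`Matrix.IsHermitian`, `Matrix.det_fin_two`, `unitary (H →L[ℂ] H)`, `LinearIsometryEquiv` and its
conjugate-linear version `H ≃ₗᵢ⋆[ℂ] H` (antiunitary operators), `SchwartzMap` and
`SchwartzMap.compCLMOfContinuousLinearEquiv`, `ContinuousLinearEquiv.neg`, `Fin.cases`,
`EuclideanSpace.proj`, `LinearMap.smulRight`. Mathlib has Pauli matrices only inside H21
(`QLattice.spinHalfPauli`, reused), no `SL(2, ℂ) → SO(1, 3)` cover, no Wightman fields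
(searched `pauli`, `Lorentz`, `Wightman`, `spinor`: no relevant Mathlib hits).

## Design choices

* `d = 3` throughout; `SpaceTime 3 = EuclideanSpace ℝ (Fin 4)`.
* `spinActFun A : SpaceTime 3 → SpaceTime 3` is a *plain function* (no bundling obligations);
  that it is (the coercion of) a restricted Lorentz transformation is the sorried
  `exists_restrictedLorentz_coe_eq_spinActFun`. Accordingly, the covariance axiom W2' is phrased
  *without choice*: for every `Λ ∈ L↑₊` with `⇑Λ = spinActFun A` the field transforms with the
  accepted `poincareTest (a, Λ)`; no `spinorPoincareTest` is defined from a `Classical.choose`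
  on a sorried existence statement (outline §0).
* `SpinorWightmanData` mirrors the accepted `WightmanData` (Hilbert space as a field with
  instance-implicit structure fields, `vacuum_mem : vacuum ∈ dom` as data-level well-formedness
  so that Wightman functions need no junk value).
* Hermiticity (SW: "the set of fields contains with each `φ` also `φ*`") is recorded as
  `IsSpinorWightmanQFT.adjoint_mem`: every component `φ_{k,α}` has an adjoint component
  `φ_{k',β}` among the fields, *of the same statistics* (`isFermi k' = isFermi k`, part of SW's
  "normal commutation relations", §3-1, eq. (3-6)), with
  `⟪χ, φ_{k,α}(f) ψ⟫ = conj ⟪ψ, φ_{k',β}(f̄) χ⟫`.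
* Locality W3±: components anticommute at spacelike separation if *both* species are Fermi,
  and commute otherwise (SW eq. (3-6), "normal commutation relations").
* `IsSpinorWightmanQFT.continuous_S` (continuity of the finite-dimensional representations
  `S k`) is recorded in W0 in addition to the outline's list: SW's `S(A)` are continuous
  (indeed holomorphic/antiholomorphic) representations of `SL(2, ℂ)` (§1-3).
* Spin–statistics (SW Thm. 4-10) is stated with the hypothesis "`S k (−1) = 1` and Fermi, or
  `S k (−1) = −1` and Bose" (`S(−1) = (−1)^{2j}` records integer/half-odd-integer spin).
* PCT (SW Thm. 4-6, eq. (4-38)) is stated on Wightman functions with the phase `i^F` written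
  explicitly (`F` = number of Fermi fields in the monomial, computed from `isFermi`) and the sign
  `(-1)^J` (`J` = total number of dotted spinor indices) in *basis-free* form: a per-species
  involution `C k` commuting with `S k`, equal to `(−1)^J` on each irreducible `D^{(j/2, l/2)}`
  summand (in an adapted basis this is SW's `i^F (−1)^J`; `SpinorWightmanData` allows reducible
  `S k` in arbitrary bases, e.g. a Dirac field, where no single `J k` works). `C` is **not**
  determined by the bare matrix representation `S k`, so it enters as `∃ C, …` — flagged **'?'**
  in the docstring (for scalar species `S k = 1` we pin `C k = 1`). Only `Θ Ω = Ω`, invariance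
  of the cyclic subspace `D₀ = span {φ⋯φ Ω}` (not of the axiomatic domain `D`), the
  `U`-intertwining part of `Θ` and the weak PCT condition on `wightmanFn` are recorded; SW's
  action of `Θ` on the fields (eqs. (4-41)–(4-42)) is omitted.
* `IsSpinorWightmanQFT.toWightman` (reduction of one-component trivial Bose multiplets to the
  accepted `IsWightmanQFT`) carries an explicit hermiticity hypothesis, since the accepted scalar
  layer axiomatises *hermitian* fields.
-/

noncomputable section

open Filter Topology ComplexConjugate Matrix Complex
open scoped InnerProductSpace SchwartzMap MatrixGroups

namespace Literature.Analysis.FunctionSpaces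

/-! ### Pauli matrices and the map `x ↦ x̰` -/

/-- The four Pauli matrices `σ_μ`, `μ : Fin 4`: `σ₀ = 1` and `σ₁ = σˣ`, `σ₂ = σʸ`, `σ₃ = σᶻ` the
accepted Pauli triple `QLattice.spinHalfPauli` (Streater–Wightman (1964), §1-3, eq. (1-18)). [cite: StreaterWightman1964] -/
def pauliMatrix : Fin 4 → Matrix (Fin 2) (Fin 2) ℂ :=
  Fin.cases 1 Literature.MathematicalPhysics.QuantumLattice.spinHalfPauli

/-- `σ₀ = 1` (unfolding of `pauliMatrix`). [folklore] -/
@[simp]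
theorem pauliMatrix_zero : pauliMatrix 0 = 1 := rfl

/-- `σ_{i+1} = spinHalfPauli i` (unfolding of `pauliMatrix`). [folklore] -/
@[simp]
theorem pauliMatrix_succ (i : Fin 3) : pauliMatrix i.succ = Literature.MathematicalPhysics.QuantumLattice.spinHalfPauli i := rfl

/-- `σ₁ = σˣ` (definitional agreement with the accepted Pauli triple; unfolding of
`pauliMatrix`). [folklore] -/
theorem pauliMatrix_one : pauliMatrix 1 = Literature.MathematicalPhysics.QuantumLattice.spinHalfPauli 0 := rfl

/-- The Pauli matrices are hermitian (Streater–Wightman (1964), §1-3). [cite: StreaterWightman1964] -/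
theorem isHermitian_pauliMatrix (μ : Fin 4) : (pauliMatrix μ).IsHermitian := by
  refine Fin.cases ?_ (fun i => ?_) μ
  · exact isHermitian_one
  · rw [pauliMatrix_succ]
    fin_cases i <;>
      · refine Matrix.IsHermitian.ext fun a b => ?_
        fin_cases a <;> fin_cases b <;> simp [Literature.MathematicalPhysics.QuantumLattice.spinHalfPauli]

/-- The Pauli matrices are self-adjoint elements of the star ring `M₂(ℂ)` (the `IsSelfAdjoint`
form of `isHermitian_pauliMatrix`, via Mathlib's `Matrix.isHermitian_iff_isSelfAdjoint`;
Streater–Wightman (1964), §1-3). [cite: StreaterWightman1964] -/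
theorem isSelfAdjoint_pauliMatrix (μ : Fin 4) : IsSelfAdjoint (pauliMatrix μ) :=
  Matrix.isHermitian_iff_isSelfAdjoint.1 (isHermitian_pauliMatrix μ)

/-- The real-linear map `x ↦ x̰ = ∑_μ x^μ σ_μ = !![x⁰ + x³, x¹ - i x²; x¹ + i x², x⁰ - x³]` from
Minkowski space to `2 × 2` (hermitian) matrices (Streater–Wightman (1964), §1-3, eq. (1-19)).
The codomain is the bare matrix ring (hermiticity is the separate lemma `isHermitian_toHermitian`);
the name is the outline's. [cite: StreaterWightman1964] -/
def toHermitian : Literature.MathematicalPhysics.QuantumLattice.SpaceTime 3 →ₗ[ℝ] Matrix (Fin 2) (Fin 2) ℂ :=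
  ∑ μ : Fin 4, ((EuclideanSpace.proj μ : Literature.MathematicalPhysics.QuantumLattice.SpaceTime 3 →L[ℝ] ℝ) : Literature.MathematicalPhysics.QuantumLattice.SpaceTime 3 →ₗ[ℝ] ℝ).smulRight
    (pauliMatrix μ)

/-- Unfolding lemma: `x̰ = ∑_μ x^μ • σ_μ` (Streater–Wightman (1964), §1-3, eq. (1-19)). [cite: StreaterWightman1964] -/
theorem toHermitian_apply (x : Literature.MathematicalPhysics.QuantumLattice.SpaceTime 3) :
    toHermitian x = ∑ μ : Fin 4, (x μ) • pauliMatrix μ := by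
  simp [toHermitian]

/-- `x̰` is hermitian for real `x` (Streater–Wightman (1964), §1-3). [cite: StreaterWightman1964] -/
theorem isHermitian_toHermitian (x : Literature.MathematicalPhysics.QuantumLattice.SpaceTime 3) : (toHermitian x).IsHermitian := by
  rw [toHermitian_apply]
  refine Finset.sum_induction _ (fun M : Matrix (Fin 2) (Fin 2) ℂ => M.IsHermitian)
    (fun _ _ ha hb => ha.add hb) isHermitian_zero fun μ _ => ?_
  unfold Matrix.IsHermitian
  rw [conjTranspose_smul, (isHermitian_pauliMatrix μ).eq]
  simp

/-- `det x̰ = (x⁰)² − (x¹)² − (x²)² − (x³)² = η(x, x)` (Streater–Wightman (1964), §1-3,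
eq. (1-20)). [cite: StreaterWightman1964] -/
theorem det_toHermitian (x : Literature.MathematicalPhysics.QuantumLattice.SpaceTime 3) :
    (toHermitian x).det = (Literature.MathematicalPhysics.QuantumLattice.minkowskiForm 3 x x : ℂ) := by
  rw [toHermitian_apply, Matrix.det_fin_two, Literature.MathematicalPhysics.QuantumLattice.minkowskiForm_apply]
  simp [Fin.sum_univ_succ, Literature.MathematicalPhysics.QuantumLattice.spinHalfPauli, Matrix.smul_apply]
  ring_nf
  simp only [Complex.I_sq]
  ring

/-! ### The action of `SL(2, ℂ)` on Minkowski space -/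

/-- The action of `A ∈ SL(2, ℂ)` on Minkowski space, `x ↦ Λ(A) x`, defined through
`(Λ(A) x)̰ = A x̰ Aᴴ`, in coordinates `(Λ(A) x)^μ = ½ Re tr (σ_μ A x̰ Aᴴ)` (using
`tr (σ_μ σ_ν) = 2 δ_{μν}`) (Streater–Wightman (1964), §1-3, eqs. (1-22)–(1-23)). A plain function;
that it is a restricted Lorentz transformation is `exists_restrictedLorentz_coe_eq_spinActFun`. [cite: StreaterWightman1964] -/
def spinActFun (A : SL(2, ℂ)) (x : Literature.MathematicalPhysics.QuantumLattice.SpaceTime 3) : Literature.MathematicalPhysics.QuantumLattice.SpaceTime 3 :=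
  WithLp.toLp 2 fun μ =>
    2⁻¹ * ((pauliMatrix μ * ((A : Matrix (Fin 2) (Fin 2) ℂ) * toHermitian x *
      (A : Matrix (Fin 2) (Fin 2) ℂ)ᴴ)).trace).re

/-- Coordinates of `spinActFun` (unfolding; Streater–Wightman (1964), §1-3, eq. (1-23)). [cite: StreaterWightman1964] -/
theorem spinActFun_apply (A : SL(2, ℂ)) (x : Literature.MathematicalPhysics.QuantumLattice.SpaceTime 3) (μ : Fin 4) :
    spinActFun A x μ =
      2⁻¹ * ((pauliMatrix μ * ((A : Matrix (Fin 2) (Fin 2) ℂ) * toHermitian x *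
        (A : Matrix (Fin 2) (Fin 2) ℂ)ᴴ)).trace).re :=
  rfl

/-- `Λ(A)` is a restricted Lorentz transformation: there is `Λ ∈ L↑₊` with `⇑Λ = spinActFun A`
(Streater–Wightman (1964), §1-3, discussion after eq. (1-23): `det (A x̰ Aᴴ) = det x̰`,
connectedness of `SL(2, ℂ)`). [cite: StreaterWightman1964] -/
def exists_restrictedLorentz_coe_eq_spinActFun : Prop :=
  ∀ (A : SL(2, ℂ)),
    ∃ Λ ∈ Literature.MathematicalPhysics.QuantumLattice.restrictedLorentzGroup 3, ⇑Λ = spinActFun A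

/-- `Λ(1) = id` (Streater–Wightman (1964), §1-3, eq. (1-24)). [cite: StreaterWightman1964] -/
theorem spinActFun_one : spinActFun 1 = id := by
  funext x
  ext μ
  rw [spinActFun_apply, toHermitian_apply]
  simp only [Matrix.SpecialLinearGroup.coe_one, one_mul, conjTranspose_one, mul_one, id]
  revert μ
  refine Fin.cases ?_ (fun i => ?_)
  · simp [Fin.sum_univ_succ, Literature.MathematicalPhysics.QuantumLattice.spinHalfPauli, Matrix.trace]
    ring
  · rw [pauliMatrix_succ]
    fin_cases i <;>
    · simp [Fin.sum_univ_succ, Literature.MathematicalPhysics.QuantumLattice.spinHalfPauli, Matrix.trace, Matrix.vecMul,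
        dotProduct]
      ring

/-- `A ↦ Λ(A)` is a homomorphism: `Λ(A B) = Λ(A) ∘ Λ(B)` (Streater–Wightman (1964), §1-3,
eq. (1-24)). [cite: StreaterWightman1964] -/
def spinActFun_mul : Prop :=
  ∀ (A B : SL(2, ℂ)),
    spinActFun (A * B) = spinActFun A ∘ spinActFun B

/-- `Λ(−A) = Λ(A)` (Streater–Wightman (1964), §1-3, eq. (1-25)). [cite: StreaterWightman1964] -/
theorem spinActFun_neg (A : SL(2, ℂ)) : spinActFun (-A) = spinActFun A := by
  funext x
  ext μ
  simp [spinActFun_apply, Matrix.conjTranspose_neg]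

/-- `A ↦ Λ(A)` is onto `L↑₊`: every restricted Lorentz transformation is `Λ(A)` for some
`A ∈ SL(2, ℂ)` (Streater–Wightman (1964), §1-3, eq. (1-25) ff.). (Not a `Function.Surjective`
statement since `spinActFun` is unbundled; the name is the outline's, the Mathlib-style name
`exists_spinActFun_eq_of_mem_restrictedLorentzGroup` is provided as an alias below.) [cite: StreaterWightman1964] -/
def spinActFun_surjective : Prop :=
  ∀ Λ ∈ Literature.MathematicalPhysics.QuantumLattice.restrictedLorentzGroup 3, ∃ A : SL(2, ℂ), ⇑Λ = spinActFun A

/-- Every `Λ ∈ L↑₊` is `Λ(A)` for some `A ∈ SL(2, ℂ)` (Mathlib-style restatement of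
`spinActFun_surjective`; Streater–Wightman (1964), §1-3, eq. (1-25) ff.). [cite: StreaterWightman1964] -/
def exists_spinActFun_eq_of_mem_restrictedLorentzGroup : Prop :=
  ∀ {Λ : Literature.MathematicalPhysics.QuantumLattice.SpaceTime 3 ≃L[ℝ] Literature.MathematicalPhysics.QuantumLattice.SpaceTime 3} (hΛ : Λ ∈ Literature.MathematicalPhysics.QuantumLattice.restrictedLorentzGroup 3),
    ∃ A : SL(2, ℂ), spinActFun A = ⇑Λ

/- interim proof relied on results that are now named facts (D-0014); demoted to a fact by the M5 import, proof preserved: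
:= by
  obtain ⟨A, hA⟩ := spinActFun_surjective Λ hΛ
  exact ⟨A, hA.symm⟩
-/

/-- The kernel of `A ↦ Λ(A)` is `{±1}`: `Λ(A) = Λ(B) ↔ A = ±B`, so `SL(2, ℂ)` is a two-fold cover
of `L↑₊` (Streater–Wightman (1964), §1-3, eq. (1-25)). [cite: StreaterWightman1964] -/
def spinActFun_eq_iff : Prop :=
  ∀ (A B : SL(2, ℂ)),
    spinActFun A = spinActFun B ↔ A = B ∨ A = -B

/-- Space-time reflection `f ↦ f(−·)` on Schwartz test functions, the test-function side of the
PCT operation (Mathlib: `SchwartzMap.compCLMOfContinuousLinearEquiv` along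
`ContinuousLinearEquiv.neg`; Streater–Wightman (1964), §4-3, eq. (4-38)). [cite: StreaterWightman1964] -/
def reflectTest : 𝓢(Literature.MathematicalPhysics.QuantumLattice.SpaceTime 3, ℂ) →L[ℂ] 𝓢(Literature.MathematicalPhysics.QuantumLattice.SpaceTime 3, ℂ) :=
  SchwartzMap.compCLMOfContinuousLinearEquiv ℂ (ContinuousLinearEquiv.neg ℝ)

/-- Pointwise formula: `reflectTest f x = f (-x)` (unfolding of `reflectTest`). [folklore] -/
@[simp]
theorem reflectTest_apply (f : 𝓢(Literature.MathematicalPhysics.QuantumLattice.SpaceTime 3, ℂ)) (x : Literature.MathematicalPhysics.QuantumLattice.SpaceTime 3) :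
    reflectTest f x = f (-x) := rfl

/-! ### Spinor Wightman data -/

/-- **Spinor Wightman data** with species indexed by `κ` on four-dimensional Minkowski space
(Streater–Wightman (1964), §3-1, with the inhomogeneous `SL(2, ℂ)` in place of the Poincaré
group): a complex Hilbert space `H`, a strongly continuous unitary representation `transl` of the
translations `ℝ⁴`, a unitary representation `spinRep : A ↦ U(0, A)` of `SL(2, ℂ)`, a vacuum
`Ω ∈ D`, a common domain `D = dom`, and for each species `k` a multiplet of `mult k` field
components `φ_{k,α}(f) : D → D`, `α : Fin (mult k)`, complex-linear in `f ∈ 𝓢(ℝ⁴, ℂ)`,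
transforming under the finite-dimensional matrix representation
`S k : SL(2, ℂ) →* M_{mult k}(ℂ)` (SW eq. (3-4)), with a Bose/Fermi flag `isFermi k` fixing the
commutation relations (SW eq. (3-6)). The axioms are `IsSpinorWightmanQFT`. Mirrors the accepted
scalar `WightmanData` (including the data-level `vacuum_mem`). [cite: StreaterWightman1964] -/
structure SpinorWightmanData (κ : Type*) where
  /-- The Hilbert space of states. -/
  H : Type
  [instNormedAddCommGroup : NormedAddCommGroup H]
  [instInnerProductSpace : InnerProductSpace ℂ H]
  [instCompleteSpace : CompleteSpace H]
  /-- The unitary representation `a ↦ U(a, 1)` of space-time translations. -/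
  transl : UnboundedOperators.UnitaryRep (Multiplicative (Literature.MathematicalPhysics.QuantumLattice.SpaceTime 3)) H
  /-- The unitary representation `A ↦ U(0, A)` of `SL(2, ℂ)`. -/
  spinRep : SL(2, ℂ) →* unitary (H →L[ℂ] H)
  /-- The vacuum vector `Ω`. -/
  vacuum : H
  /-- The common dense invariant domain `D` of the field operators. -/
  dom : Submodule ℂ H
  /-- The vacuum lies in the domain, `Ω ∈ D`. -/
  vacuum_mem : vacuum ∈ dom
  /-- The number of components of the multiplet of species `k`. -/
  mult : κ → ℕ
  /-- The finite-dimensional matrix representation `A ↦ S^{(k)}(A)` of `SL(2, ℂ)` under which the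
  multiplet `k` transforms. -/
  S : (k : κ) → SL(2, ℂ) →* Matrix (Fin (mult k)) (Fin (mult k)) ℂ
  /-- Whether species `k` is a Fermi field (anticommuting at spacelike separation with other Fermi
  fields) or a Bose field. -/
  isFermi : κ → Bool
  /-- The smeared field components `f ↦ φ_{k,α}(f) : D → D`, complex-linear in `f`. -/
  field : (k : κ) → Fin (mult k) → 𝓢(Literature.MathematicalPhysics.QuantumLattice.SpaceTime 3, ℂ) →ₗ[ℂ] (dom →ₗ[ℂ] dom)

attribute [instance] SpinorWightmanData.instNormedAddCommGroup
  SpinorWightmanData.instInnerProductSpace SpinorWightmanData.instCompleteSpace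

namespace SpinorWightmanData

variable {κ : Type*} (W : SpinorWightmanData κ)

/-- The vacuum as an element of the domain `D` (as in the accepted `WightmanData.vacuumDom`). [folklore] -/
def vacuumDom : W.dom := ⟨W.vacuum, W.vacuum_mem⟩

/-- `↑W.vacuumDom = W.vacuum` (unfolding of `vacuumDom`). [folklore] -/
@[simp]
theorem coe_vacuumDom : (W.vacuumDom : W.H) = W.vacuum := rfl

/-- The operator `U(a, A) := U(a, 1) U(0, A) = transl a * spinRep A` attached to
`(a, A) ∈ ℝ⁴ ⋊ SL(2, ℂ)` (acting on space-time by `x ↦ Λ(A) x + a`); same ordering convention as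
the accepted `WightmanData.U` (Streater–Wightman (1964), §3-1, eq. (3-2)). [cite: StreaterWightman1964] -/
def U (a : Literature.MathematicalPhysics.QuantumLattice.SpaceTime 3) (A : SL(2, ℂ)) : W.H →L[ℂ] W.H :=
  W.transl (Multiplicative.ofAdd a) * (W.spinRep A : W.H →L[ℂ] W.H)

/-- `U(0, 1) = 1` (unfolding of `U`). [folklore] -/
@[simp]
theorem U_zero_one : W.U 0 1 = 1 := by
  simp [U]

/-- `U(a, A)` is unitary (product of unitaries; Streater–Wightman (1964), §3-1). [cite: StreaterWightman1964] -/
theorem U_mem_unitary (a : Literature.MathematicalPhysics.QuantumLattice.SpaceTime 3) (A : SL(2, ℂ)) : W.U a A ∈ unitary (W.H →L[ℂ] W.H) :=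
  Submonoid.mul_mem _ (W.transl.mem_unitary _) (W.spinRep A).2

/-- A *labelled component*: a species `k`, a component index `α : Fin (mult k)` and a test
function `f`; the letters of field monomials. [folklore] -/
abbrev Letter : Type _ := (k : κ) × Fin (W.mult k) × 𝓢(Literature.MathematicalPhysics.QuantumLattice.SpaceTime 3, ℂ)

/-- The field monomial `φ_{k₁,α₁}(f₁) ⋯ φ_{kₙ,αₙ}(fₙ) : D → D` attached to a list of letters (the
empty list gives the identity) (Streater–Wightman (1964), §3-1, W4; §3-3). [cite: StreaterWightman1964] -/
def fieldMonomial (l : List W.Letter) : W.dom →ₗ[ℂ] W.dom :=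
  l.foldr (fun p A => W.field p.1 p.2.1 p.2.2 ∘ₗ A) LinearMap.id

/-- The empty monomial is the identity (unfolding of `fieldMonomial`). [folklore] -/
@[simp]
theorem fieldMonomial_nil : W.fieldMonomial [] = LinearMap.id := rfl

/-- `fieldMonomial (p :: l) = φ_p ∘ fieldMonomial l` (unfolding of `fieldMonomial`). [folklore] -/
@[simp]
theorem fieldMonomial_cons (p : W.Letter) (l : List W.Letter) :
    W.fieldMonomial (p :: l) = W.field p.1 p.2.1 p.2.2 ∘ₗ W.fieldMonomial l := rfl

/-- The `n`-point **Wightman function** of the components `(kᵢ, αᵢ)` smeared with one-point test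
functions, `𝔚ₙ(f₁, …, fₙ) = ⟪Ω, φ_{k₁,α₁}(f₁) ⋯ φ_{kₙ,αₙ}(fₙ) Ω⟫`
(Streater–Wightman (1964), §3-3, eq. (3-19)). [cite: StreaterWightman1964] -/
def wightmanFn (n : ℕ) (k : Fin n → κ) (α : (i : Fin n) → Fin (W.mult (k i)))
    (f : Fin n → 𝓢(Literature.MathematicalPhysics.QuantumLattice.SpaceTime 3, ℂ)) : ℂ :=
  ⟪W.vacuum, (W.fieldMonomial (List.ofFn fun i => ⟨k i, α i, f i⟩) W.vacuumDom : W.H)⟫_ℂ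

/-- The spinor Wightman data have **mass gap** `Δ`: literally G07's
`UnitaryRep.HasMassGapWithUniqueVacuum` for `W.transl` and `W.vacuum`, exactly as the accepted
`WightmanData.HasMassGap` (Jaffe–Witten (2000), §5; Streater–Wightman (1964), §3-1). [cite: JaffeWitten2000] -/
def HasMassGap (Δ : ℝ) : Prop :=
  W.transl.HasMassGapWithUniqueVacuum W.vacuum Δ

/-- Two spinor Wightman data are **unitarily equivalent** if a unitary `V : H ≃ H'` maps vacuum
to vacuum, domain onto domain and intertwines translations, `SL(2, ℂ)` and all field components;
the multiplet data (`mult`, `S`, `isFermi`) must agree (Streater–Wightman (1964), §3-4,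
Thm. 3-7). The membership `V ψ ∈ D'` is an explicit hypothesis, as in the accepted
`WightmanData.IsUnitarilyEquivalent`. [cite: StreaterWightman1964] -/
def IsUnitarilyEquivalent (W W' : SpinorWightmanData κ) : Prop :=
  ∃ hmult : W.mult = W'.mult,
    (∀ k A, (W'.S k A).submatrix (Fin.cast (congrFun hmult k)) (Fin.cast (congrFun hmult k)) =
      W.S k A) ∧
    W.isFermi = W'.isFermi ∧
    ∃ V : W.H ≃ₗᵢ[ℂ] W'.H,
      V W.vacuum = W'.vacuum ∧
      (∀ a ψ, V (W.transl a ψ) = W'.transl a (V ψ)) ∧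
      (∀ A ψ, V ((W.spinRep A : W.H →L[ℂ] W.H) ψ) = (W'.spinRep A : W'.H →L[ℂ] W'.H) (V ψ)) ∧
      Submodule.map (V.toLinearEquiv : W.H →ₗ[ℂ] W'.H) W.dom = W'.dom ∧
      ∀ (k : κ) (α : Fin (W.mult k)) (f : 𝓢(Literature.MathematicalPhysics.QuantumLattice.SpaceTime 3, ℂ)) (ψ : W.dom) (hψ : V ψ ∈ W'.dom),
        V (W.field k α f ψ) = W'.field k (Fin.cast (congrFun hmult k) α) f ⟨V ψ, hψ⟩

/-- Unitary equivalence is reflexive (Streater–Wightman (1964), §3-4). [cite: StreaterWightman1964] -/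
theorem IsUnitarilyEquivalent.refl (W : SpinorWightmanData κ) : W.IsUnitarilyEquivalent W := by
  refine ⟨rfl, fun _ _ => rfl, rfl, LinearIsometryEquiv.refl ℂ W.H, rfl, fun _ _ => rfl,
    fun _ _ => rfl, ?_, fun _ _ _ _ _ => rfl⟩
  ext ψ
  simp only [Submodule.mem_map_equiv]
  exact Iff.rfl

/-- Unitary equivalence is symmetric (Streater–Wightman (1964), §3-4): transport back along
`V.symm`. [cite: StreaterWightman1964] -/
theorem IsUnitarilyEquivalent.symm {W W' : SpinorWightmanData κ} (h : W.IsUnitarilyEquivalent W') :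
    W'.IsUnitarilyEquivalent W := by
  obtain ⟨H', transl', spinRep', vac', dom', hvac', mult', S', isFermi', field'⟩ := W'
  obtain ⟨hmult, hS, hF, V, hvac, htransl, hspin, hdom, hfield⟩ := h
  dsimp only at hmult hS hF V hvac htransl hspin hdom hfield
  subst hmult hF
  have hdom' : Submodule.map (V.symm.toLinearEquiv : H' →ₗ[ℂ] W.H) dom' = W.dom := by
    have h2 : Submodule.map (V.symm.toLinearEquiv : H' →ₗ[ℂ] W.H)
        (Submodule.map (V.toLinearEquiv : W.H →ₗ[ℂ] H') W.dom) = W.dom := by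
      rw [← Submodule.map_comp]
      convert Submodule.map_id W.dom
      ext x
      simp
    rwa [hdom] at h2
  refine ⟨rfl, fun k A => ?_, rfl, V.symm, ?_, fun a ψ => ?_, fun A ψ => ?_, hdom',
    fun k α f ψ hψ => ?_⟩ <;> dsimp only at *
  · simpa using (hS k A).symm
  · apply V.injective
    rw [LinearIsometryEquiv.apply_symm_apply, hvac]
  · apply V.injective
    simp [htransl]
  · apply V.injective
    simp [hspin]
  · apply V.injective
    have hmem : V ((⟨V.symm ψ, hψ⟩ : W.dom) : W.H) ∈ dom' := by simp
    have := hfield k α f ⟨V.symm ψ, hψ⟩ hmem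
    simp only [Fin.cast_eq_self] at this ⊢
    rw [this, LinearIsometryEquiv.apply_symm_apply]
    congr 2
    ext
    simp

end SpinorWightmanData

/-! ### The Wightman axioms for spinor fields -/

/-- **The Wightman axioms for spinor multiplets** (Streater–Wightman (1964), §3-1, with
`ISL(2, ℂ)`; Jost (1965), ch. V). W0: strong continuity of `A ↦ U(0, A)`, the semidirect-product
relation `U(A) U(a) U(A)⁻¹ = U(Λ(A) a)`, continuity of the `S^{(k)}`, spectral condition,
uniqueness, `SL(2, ℂ)`-invariance and normalisation of the vacuum; W1: dense invariant common
domain, temperedness, and closure of the set of components under adjoints, the adjoint having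
the same statistics (SW eq. (3-6)); W2': the transformation law
`U(a, A) φ_{k,α}(f) U(a, A)⁻¹ = ∑_β S^{(k)}(A⁻¹)_{αβ} φ_{k,β}({a, Λ(A)} f)` (SW eq. (3-4)),
phrased for every `Λ ∈ L↑₊` with `⇑Λ = spinActFun A` (which exists and is unique by
`exists_restrictedLorentz_coe_eq_spinActFun`); W3±: at spacelike separation two components
anticommute if both species are Fermi and commute otherwise (SW eq. (3-6)); W4: cyclicity of
the vacuum. [cite: StreaterWightman1964] -/
structure IsSpinorWightmanQFT {κ : Type*} (W : SpinorWightmanData κ) : Prop where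
  -- W0
  /-- W0: `A ↦ U(0, A) ψ` is continuous on `SL(2, ℂ)`. -/
  strongCont_spinRep : ∀ ψ : W.H, Continuous fun A : SL(2, ℂ) => (W.spinRep A : W.H →L[ℂ] W.H) ψ
  /-- W0: the matrix representations `S^{(k)}` are continuous. -/
  continuous_S : ∀ k, Continuous (W.S k)
  /-- W0: `U(0, A) U(a, 1) U(0, A)⁻¹ = U(Λ(A) a, 1)`. -/
  spin_transl : ∀ (A : SL(2, ℂ)) (a : Multiplicative (Literature.MathematicalPhysics.QuantumLattice.SpaceTime 3)),
    (W.spinRep A : W.H →L[ℂ] W.H) * W.transl a * (W.spinRep A⁻¹ : W.H →L[ℂ] W.H) =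
      W.transl (Multiplicative.ofAdd (spinActFun A a.toAdd))
  /-- W0, spectral condition: the energy–momentum spectrum lies in the closed forward cone. -/
  spectral : W.transl.HasFourierSpectrumIn (Literature.MathematicalPhysics.QuantumLattice.closedForwardCone 3)
  /-- W0: `Ω` is, up to scalars, the unique translation-invariant vector. -/
  uniqueVacuum : W.transl.HasUniqueVacuum W.vacuum
  /-- W0: the vacuum is `SL(2, ℂ)`-invariant. -/
  spinRep_vacuum : ∀ A : SL(2, ℂ), (W.spinRep A : W.H →L[ℂ] W.H) W.vacuum = W.vacuum
  /-- W0: the vacuum is a unit vector. -/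
  norm_vacuum : ‖W.vacuum‖ = 1
  -- W1
  /-- W1: the domain `D` is dense. -/
  dense_dom : Dense (W.dom : Set W.H)
  /-- W1: `D` is invariant under translations. -/
  transl_dom : ∀ (a : Multiplicative (Literature.MathematicalPhysics.QuantumLattice.SpaceTime 3)) (ψ : W.H), ψ ∈ W.dom → W.transl a ψ ∈ W.dom
  /-- W1: `D` is invariant under `SL(2, ℂ)`. -/
  spinRep_dom : ∀ (A : SL(2, ℂ)) (ψ : W.H), ψ ∈ W.dom → (W.spinRep A : W.H →L[ℂ] W.H) ψ ∈ W.dom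
  /-- W1: `f ↦ ⟪χ, φ_{k,α}(f) ψ⟫` is a tempered distribution. -/
  tempered : ∀ (k : κ) (α : Fin (W.mult k)) (ψ χ : W.dom),
    Continuous fun f : 𝓢(Literature.MathematicalPhysics.QuantumLattice.SpaceTime 3, ℂ) => ⟪(χ : W.H), (W.field k α f ψ : W.H)⟫_ℂ
  /-- W1: the set of field components is closed under adjoints — every `φ_{k,α}` has an adjoint
  component `φ_{k',β}` *of the same statistics* (`isFermi k' = isFermi k`; normal commutation
  relations, SW §3-1, eq. (3-6)) with `⟪χ, φ_{k,α}(f) ψ⟫ = conj ⟪ψ, φ_{k',β}(f̄) χ⟫` on `D`. -/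
  adjoint_mem : ∀ (k : κ) (α : Fin (W.mult k)), ∃ (k' : κ) (β : Fin (W.mult k')),
    W.isFermi k' = W.isFermi k ∧ ∀ (f : 𝓢(Literature.MathematicalPhysics.QuantumLattice.SpaceTime 3, ℂ)) (ψ χ : W.dom),
      ⟪(χ : W.H), (W.field k α f ψ : W.H)⟫_ℂ =
        conj ⟪(ψ : W.H), (W.field k' β (Literature.MathematicalPhysics.QuantumLattice.starTest f) χ : W.H)⟫_ℂ
  -- W2'
  /-- W2', spinor transformation law: for `Λ = Λ(A)`,
  `U(a, A) φ_{k,α}(f) ψ = ∑_β S^{(k)}(A⁻¹)_{αβ} φ_{k,β}({a, Λ} f) U(a, A) ψ` on `D`, where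
  `({a, Λ} f)(x) = f(Λ⁻¹(x − a))` is the accepted `poincareTest`. -/
  covariant : ∀ (a : Literature.MathematicalPhysics.QuantumLattice.SpaceTime 3) (A : SL(2, ℂ)) (Λ : Literature.MathematicalPhysics.QuantumLattice.restrictedLorentzGroup 3),
    ⇑(Λ : Literature.MathematicalPhysics.QuantumLattice.SpaceTime 3 ≃L[ℝ] Literature.MathematicalPhysics.QuantumLattice.SpaceTime 3) = spinActFun A →
    ∀ (k : κ) (α : Fin (W.mult k)) (f : 𝓢(Literature.MathematicalPhysics.QuantumLattice.SpaceTime 3, ℂ)) (ψ : W.dom) (hψ : W.U a A ψ ∈ W.dom),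
      W.U a A (W.field k α f ψ : W.H) =
        ∑ β, W.S k A⁻¹ α β •
          (W.field k β (Literature.MathematicalPhysics.QuantumLattice.poincareTest (⟨Multiplicative.ofAdd a, Λ⟩ : Literature.MathematicalPhysics.QuantumLattice.PoincareGroup 3) f)
            ⟨W.U a A ψ, hψ⟩ : W.H)
  -- W3±
  /-- W3±, locality with normal commutation relations: at spacelike separation two components
  anticommute if both species are Fermi fields, and commute otherwise. -/
  locality : ∀ (k k' : κ) (α : Fin (W.mult k)) (β : Fin (W.mult k')) (f g : 𝓢(Literature.MathematicalPhysics.QuantumLattice.SpaceTime 3, ℂ))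
    (ψ : W.dom), Literature.MathematicalPhysics.QuantumLattice.AreSpacelikeSeparated (tsupport f) (tsupport g) →
      W.field k α f (W.field k' β g ψ) =
        (if W.isFermi k && W.isFermi k' then -1 else (1 : ℂ)) • W.field k' β g (W.field k α f ψ)
  -- W4
  /-- W4, cyclicity of the vacuum: field monomials applied to `Ω` span a dense subspace. -/
  cyclic : Dense ((Submodule.span ℂ (Set.range fun l : List W.Letter =>
    (W.fieldMonomial l W.vacuumDom : W.H))) : Set W.H)

namespace IsSpinorWightmanQFT

variable {κ : Type*} {W : SpinorWightmanData κ}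

/-- Under the axioms `D` is invariant under `U(a, A)` (Streater–Wightman (1964), §3-1, W1). [cite: StreaterWightman1964] -/
theorem U_mem_dom (hW : IsSpinorWightmanQFT W) (a : Literature.MathematicalPhysics.QuantumLattice.SpaceTime 3) (A : SL(2, ℂ)) {ψ : W.H}
    (hψ : ψ ∈ W.dom) : W.U a A ψ ∈ W.dom :=
  hW.transl_dom _ _ (hW.spinRep_dom _ _ hψ)

/-- The vacuum is invariant: `U(a, A) Ω = Ω` (Streater–Wightman (1964), §3-1, W0). [cite: StreaterWightman1964] -/
theorem U_vacuum (hW : IsSpinorWightmanQFT W) (a : Literature.MathematicalPhysics.QuantumLattice.SpaceTime 3) (A : SL(2, ℂ)) :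
    W.U a A W.vacuum = W.vacuum := by
  have ht : W.transl (Multiplicative.ofAdd a) W.vacuum = W.vacuum :=
    (W.transl.mem_invariantVectors_iff W.vacuum).1 hW.uniqueVacuum.1.1 _
  simp [SpinorWightmanData.U, ht, hW.spinRep_vacuum]

/-- Under the axioms a mass gap of the time translations already gives
`SpinorWightmanData.HasMassGap`. [folklore] -/
theorem hasMassGap_iff (hW : IsSpinorWightmanQFT W) (Δ : ℝ) :
    W.HasMassGap Δ ↔ W.transl.timeTranslations.HasMassGap W.vacuum Δ :=
  ⟨fun h => h.2, fun h => ⟨hW.uniqueVacuum, h⟩⟩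

end IsSpinorWightmanQFT

/-! ### PCT, spin and statistics -/

section Theorems

variable {κ : Type*} {W : SpinorWightmanData κ}

/-- **Spin–statistics theorem** (Streater–Wightman (1964), §4-4, Thm. 4-10; Burgoyne 1958,
Lüders–Zumino 1958). In a spinor Wightman QFT (with normal commutation relations, in particular
`φ` and `φ*` of the same statistics, `IsSpinorWightmanQFT.adjoint_mem`), if the multiplet `k` has
the *wrong* connection between spin and statistics — `S^{(k)}(−1) = (−1)^{2j} = 1` (integer
spin) for a Fermi field, or `S^{(k)}(−1) = −1` (half-odd-integer spin) for a Bose field — then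
all its components vanish, `φ_{k,α}(f) = 0`. (Junk case: for an empty multiplet, `mult k = 0`,
both disjuncts of `hwrong` hold trivially in `M₀(ℂ)` and the conclusion is vacuous.) [cite: StreaterWightman1964] -/
def spin_statistics : Prop :=
  ∀ (hW : IsSpinorWightmanQFT W) (k : κ) (hwrong : (W.S k (-1) = 1 ∧ W.isFermi k = true) ∨ (W.S k (-1) = -1 ∧ W.isFermi k = false)),
    ∀ (α : Fin (W.mult k)) (f : 𝓢(Literature.MathematicalPhysics.QuantumLattice.SpaceTime 3, ℂ)), W.field k α f = 0

/-- **PCT theorem** (Streater–Wightman (1964), §4-3, Thm. 4-6, eqs. (4-37)–(4-38); Jost 1957).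
In a spinor Wightman QFT there is an antiunitary operator `Θ` (a conjugate-linear isometric
bijection of `H`) with `Θ Ω = Ω`, `Θ D₀ ⊆ D₀` where `D₀ = span {φ⋯φ Ω}` is the cyclic subspace
spanned by field monomials applied to the vacuum (SW construct `Θ` on `D₀` and extend by
continuity; nothing is asserted about the axiomatic domain `D ⊇ D₀`), `Θ U(a, A) = U(−a, A) Θ`,
and the Wightman functions satisfy the PCT condition, in basis-free form
`⟪Ω, φ_{α₁}(f₁) ⋯ φ_{αₙ}(fₙ) Ω⟫ = i^F ∑_β (∏ᵢ C^{(kᵢ)}_{αᵢβᵢ}) ⟪Ω, φ_{βₙ}(f̂ₙ) ⋯ φ_{β₁}(f̂₁) Ω⟫`,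
`f̂(x) = f(−x)`, where `F` is the number of Fermi fields among `φ₁, …, φₙ` and, for each species
`k`, `C^{(k)}` is an involution (`C² = 1`) commuting with the representation `S^{(k)}`: on each
irreducible summand `D^{(j/2, l/2)}` of `S^{(k)}` it is `(−1)^J`, `J = l` the number of dotted
indices, so in a basis adapted to the decomposition into irreducibles `∏ᵢ C_{αᵢβᵢ}` is diagonal
and the identity is literally SW's `i^F (−1)^J` (eq. (4-38)); for a scalar species (`S^{(k)} = 1`,
`J = 0`) we require `C^{(k)} = 1` outright. **Flag '?'**: `C` is not determined by the bare matrix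
representations `S k` recorded in `SpinorWightmanData` (it needs the decomposition into
`D^{(j/2, l/2)}`), so it enters existentially, `∃ C, …` (weaker than SW for non-scalar reducible
multiplets); the phase `i^F` is SW's, transcribed literally (`F` counts `φ*` as Fermi iff `φ` is,
cf. `IsSpinorWightmanQFT.adjoint_mem`). Only the `U`-intertwining part of `Θ` and the weak PCT
condition on `wightmanFn` are recorded here; SW's action of `Θ` on the field operators themselves
(eqs. (4-41)–(4-42)) is omitted. [cite: StreaterWightman1964] -/
def pct_theorem : Prop :=
  ∀ (hW : IsSpinorWightmanQFT W),
    ∃ Θ : W.H ≃ₗᵢ⋆[ℂ] W.H,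
      Θ W.vacuum = W.vacuum ∧
      (∀ l : List W.Letter, Θ (W.fieldMonomial l W.vacuumDom : W.H) ∈
        Submodule.span ℂ (Set.range fun l : List W.Letter =>
          (W.fieldMonomial l W.vacuumDom : W.H))) ∧
      (∀ (a : Literature.MathematicalPhysics.QuantumLattice.SpaceTime 3) (A : SL(2, ℂ)) (ψ : W.H), Θ (W.U a A ψ) = W.U (-a) A (Θ ψ)) ∧
      ∃ C : (k : κ) → Matrix (Fin (W.mult k)) (Fin (W.mult k)) ℂ,
        (∀ k, C k * C k = 1) ∧ (∀ k A, C k * W.S k A = W.S k A * C k) ∧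
        (∀ k, W.S k = 1 → C k = 1) ∧
        ∀ (n : ℕ) (k : Fin n → κ) (α : (i : Fin n) → Fin (W.mult (k i)))
          (f : Fin n → 𝓢(Literature.MathematicalPhysics.QuantumLattice.SpaceTime 3, ℂ)),
          W.wightmanFn n k α f =
            I ^ (Finset.univ.filter fun i => W.isFermi (k i) = true).card *
              ∑ β : (i : Fin n) → Fin (W.mult (k i)), (∏ i, C (k i) (α i) (β i)) *
                W.wightmanFn n (fun i => k (Fin.rev i)) (fun i => β (Fin.rev i))
                  (fun i => reflectTest (f (Fin.rev i)))

/-- **Hermitian scalar multiplets are scalar Wightman fields.** If every multiplet has one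
component transforming trivially (`mult k = 1`, `S k = 1`), Bose statistics, and is *hermitian*
(`⟪χ, φ_k(f) ψ⟫ = conj ⟪ψ, φ_k(f̄) χ⟫` for the same species `k` — the accepted scalar layer
`IsWightmanQFT.hermitian` is an axiom system for hermitian fields, whereas
`IsSpinorWightmanQFT.adjoint_mem` only puts the adjoint of `φ_{k,α}` somewhere among the
components; without `hherm` the statement is false, e.g. for `κ = Fin 2`, `φ₀ = i φ`,
`φ₁ = −i φ`), then there are scalar Wightman data `W' : WightmanData 3 κ` satisfying the accepted
`IsWightmanQFT` with the same Wightman functions (the Lorentz representation `U(0, Λ)` descends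
from `SL(2, ℂ)` to `L↑₊` because `U(0, −1)` acts trivially by W2', W4;
Streater–Wightman (1964), §3-1). This is the outline's `toScalar` (whose one-line description
omitted hermiticity); the name `toWightman` is the one fixed by the work item. [cite: StreaterWightman1964] -/
def IsSpinorWightmanQFT.toWightman : Prop :=
  ∀ (hW : IsSpinorWightmanQFT W) (h : ∀ k, W.mult k = 1 ∧ W.isFermi k = false ∧ W.S k = 1) (hherm : ∀ (k : κ) (α : Fin (W.mult k)) (f : 𝓢(Literature.MathematicalPhysics.QuantumLattice.SpaceTime 3, ℂ)) (ψ χ : W.dom), ⟪(χ : W.H), (W.field k α f ψ : W.H)⟫_ℂ = conj ⟪(ψ : W.H), (W.field k α (Literature.MathematicalPhysics.QuantumLattice.starTest f) χ : W.H)⟫_ℂ),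
    ∃ W' : Literature.MathematicalPhysics.QuantumLattice.WightmanData 3 κ, Literature.MathematicalPhysics.QuantumLattice.IsWightmanQFT W' ∧
      ∀ (n : ℕ) (k : Fin n → κ) (f : Fin n → 𝓢(Literature.MathematicalPhysics.QuantumLattice.SpaceTime 3, ℂ)),
        W'.wightmanFn n k f = W.wightmanFn n k (fun i => Fin.cast (h (k i)).1.symm 0) f

end Theorems

end Literature.Analysis.FunctionSpaces
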